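import Literature.NumberTheory.EllipticCurves.TateCurve.TorsionRoot
import Literature.NumberTheory.EllipticCurves.TateCurve.TorsionRootTwist
import Literature.NumberTheory.EllipticCurves.TateCurve.Discriminant
import Literature.NumberTheory.EllipticCurves.TateCurve.TateParameter
import Literature.NumberTheory.EllipticCurves.TwoTorsionCardProofs
import HarnessLib

/-!
# Four rational `2`-torsion points force a square root of the Tate parameter — with NO splitness
# (the `2`-part of [IUTchI] Example 3.2 (iv) "`q_v` admits a `2l`-th root in `K_v̲`", by the discriminant argument)

Topic `Literature/NumberTheory/EllipticCurves/TateCurve`, namespace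
`Literature.NumberTheory.EllipticCurves.TateCurve`; proof-only companion of `TorsionRoot.lean`
(cell abc-iut, seat abc-iut-w5-d047; classical — Silverman *AEC* III.1.7 and *ATAEC* V.3.1 (b) — and
takes no side on anything disputed).

`TorsionRoot.lean` (`exists_pow_eq_of_torsion_of_variableChange`) extracts an `n`-th root of `q` from
`n²` rational `n`-torsion points of a curve `E` **given a `K`-isomorphism `C • E = E_q`**, i.e. given
SPLIT multiplicative reduction (Silverman ATAEC V.5.3 (b)). For `n = 2` no such isomorphism is needed:
if `E/K` is ANY elliptic curve over a complete ultrametric field of characteristic `0` with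
`j(E) = j(E_q)` (`tateJ q = E.j`, `0 < ‖q‖ < 1`) — so `E` is `E_q` or a quadratic twist of it — and
`E(K)` contains four points killed by `2`, then `q` is a square in `K`. The mechanism is the parity
(square class) of the discriminant:

* `E[2] ⊆ E(K)` means that the `2`-division cubic `4x³ + b₂x² + 2b₄x + b₆` has three roots
  `e₁, e₂, e₃ ∈ K`, whence `Δ(E) = 16·((e₁ − e₂)(e₁ − e₃)(e₂ − e₃))²` is a square
  (Silverman *AEC* III.1.7 (proof); Mathlib `Cubic.discr_eq_prod_three_roots`,
  `WeierstrassCurve.twoTorsionPolynomial_discr`) — `WeierstrassCurve.isSquare_Δ_of_two_torsion`;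
* for every elliptic Weierstrass equation `c₆² = Δ·(j − 1728)` (Mathlib `c_relation`
  `1728Δ = c₄³ − c₆²` and `jΔ = c₄³`) — `WeierstrassCurve.c₆_sq_eq_Δ_mul_j_sub`; since
  `‖j(E)‖ = ‖j(E_q)‖ = ‖q‖⁻¹ > 1 ≥ ‖1728‖`, `j − 1728 ≠ 0`, so `Δ(E_q)` and `Δ(E)` have the SAME
  square class (that of `j − 1728`), and `Δ(E)` is a square;
* `Δ(E_q) = q·∏_{n≥1}(1 − qⁿ)²⁴` (ATAEC V.3.1 (b), PROVED in the tree: `tateCurve_discr`) and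
  `∏(1 − qⁿ)²⁴ = (∏(1 − qⁿ)¹²)²` (`tprod_tateDelta_factor_eq_sq`), so `q` is a square:
  `exists_sq_eq_of_two_torsion`.

Combined with an `n`-th root of `q` for an ODD `n` — `TorsionRootTwist.lean` (seat abc-iut-w5-d181,
`exists_pow_eq_tateParameter_of_odd_torsion`) obtains one from `n²` rational `n`-torsion points, again
without splitness — through `exists_pow_mul_eq_of_coprime` (`TorsionRoot.lean`, Bezout), this gives
the `2n`-th root from the torsion counts ALONE: `exists_pow_two_mul_eq_of_torsion` (and
`…_tateParameter_of_torsion`, `…_norm_of_torsion` with `‖j(E)‖ = ‖c‖^{-2n}`); with `n = l` this is the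
"`2l`-th root `q̲_v` of `q_v`" of [IUTchI] Ex. 3.2 (iv) from Def. 3.1 (b) (`E_F[2] ⊆ E_F(F)`) and (c)
(`K = F(E_F[l])`), WITHOUT first establishing split multiplicative reduction over `K_v̲`.

## References
* [SilvermanAEC2009] J. H. Silverman, *The Arithmetic of Elliptic Curves*, 2nd ed., GTM 106 (2009),
  III.§1 (`c₄`, `c₆`, `Δ`, `j`; Prop. III.1.7 and its proof: `Δ = 16∏(eᵢ − eⱼ)²` in Legendre
  coordinates), III.§2 / Ex. 3.7 (the `2`-torsion points are the `(x, y)` with `x` a root of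
  `4x³ + b₂x² + 2b₄x + b₆`).
* [SilvermanATAEC1994] J. H. Silverman, *Advanced Topics in the Arithmetic of Elliptic Curves*,
  GTM 151, Springer 1994, Thm. V.3.1 (b) (PDF pp. 394–396): `Δ(E_q) = q∏(1 − qⁿ)²⁴`,
  `j(E_q) = 1/q + 744 + ⋯`; Lemma V.5.2 / Thm. V.5.3 (quadratic twists of `E_q`, PDF pp. 406–409).
* [Mochizuki2012] S. Mochizuki, *Inter-universal Teichmüller theory I*, Example 3.2 (iv), kurims
  May-2020 manuscript p. 71 (consumer only; nothing of it is asserted here).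
-/

noncomputable section

open scoped Classical

/-! ### Curves over an arbitrary field: `E[2] ⊆ E(K)` makes `Δ` a square; `c₆² = Δ(j − 1728)` -/

namespace WeierstrassCurve

open Polynomial

universe u

variable {F : Type u} [Field F] (W : WeierstrassCurve F)

/-- **Four rational points killed by `2` make the `2`-division cubic split.** If `2 ≠ 0` in `F` and
`W(F)` contains a `Finset` of at least four points `P` with `2 • P = O`, then the cubic
`4x³ + b₂x² + 2b₄x + b₆` has three roots `e₁, e₂, e₃` in `F` (as a multiset of roots,
`{e₁, e₂, e₃}`): the three non-zero such points have pairwise distinct abscissae (the ordinate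
`y = −(a₁x + a₃)/2` is determined by `x`), each a root of the cubic. Silverman, *AEC*, III.§2 and
Ex. 3.7. [cite: SilvermanAEC2009, III.§2 / Exercise 3.7 (the `2`-torsion abscissae)] -/
theorem exists_roots_twoTorsionPolynomial_of_two_torsion (h2 : (2 : F) ≠ 0)
    (S : Finset W.toAffine.Point) (hS : ∀ P ∈ S, (2 : ℕ) • P = 0) (hcard : 4 ≤ S.card) :
    ∃ e₁ e₂ e₃ : F, (Cubic.map (RingHom.id F) W.twoTorsionPolynomial).roots = {e₁, e₂, e₃} := by
  classical
  set g : F[X] := W.twoTorsionPolynomial.toPoly with hg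
  have h4 : (4 : F) ≠ 0 := by
    rw [show (4 : F) = 2 * 2 by norm_num]
    exact mul_ne_zero h2 h2
  have ha : W.twoTorsionPolynomial.a ≠ 0 := h4
  have hdeg : g.natDegree = 3 := Cubic.natDegree_of_a_ne_zero (P := W.twoTorsionPolynomial) h4
  have hS' : ∀ P ∈ S, P + P = 0 := fun P hP ↦ by rw [← two_nsmul]; exact hS P hP
  -- the abscissa map, injective on the points killed by `2`, with values `none` or `some (root)`
  let xo : W.toAffine.Point → Option F := fun P ↦ match P with
    | .zero => none
    | .some x _ _ => some x
  have hinj : Set.InjOn xo ↑S := by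
    rintro (_ | ⟨x₁, y₁, h₁⟩) hP (_ | ⟨x₂, y₂, h₂⟩) hQ hPQ
    · rfl
    · exact absurd hPQ (by simp [xo])
    · exact absurd hPQ (by simp [xo])
    · have hx : x₁ = x₂ := by simpa [xo] using hPQ
      subst hx
      have hy₁ := (W.isRoot_twoTorsionPolynomial_of_add_self_eq_zero (hS' _ hP)).1
      have hy₂ := (W.isRoot_twoTorsionPolynomial_of_add_self_eq_zero (hS' _ hQ)).1
      rw [Affine.negY] at hy₁ hy₂
      have hy : y₁ = y₂ := by
        have : (2 : F) * (y₁ - y₂) = 0 := by linear_combination hy₁ - hy₂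
        exact sub_eq_zero.mp ((mul_eq_zero.mp this).resolve_left h2)
      subst hy
      rfl
  have hsub : S.image xo ⊆ insert none (g.roots.toFinset.image some) := by
    intro o ho
    obtain ⟨P, hP, rfl⟩ := Finset.mem_image.mp ho
    rcases P with _ | ⟨x, y, h⟩
    · exact Finset.mem_insert_self _ _
    · refine Finset.mem_insert_of_mem (Finset.mem_image.mpr ⟨x, ?_, rfl⟩)
      rw [Multiset.mem_toFinset, Polynomial.mem_roots (Cubic.ne_zero_of_a_ne_zero ha)]
      exact (W.isRoot_twoTorsionPolynomial_of_add_self_eq_zero (hS' _ hP)).2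
  -- hence the cubic has (at least, so exactly) three roots in `F`
  have hcount : 3 ≤ g.roots.card := by
    have h1 : S.card ≤ 1 + g.roots.toFinset.card := by
      calc S.card = (S.image xo).card := (Finset.card_image_of_injOn hinj).symm
        _ ≤ (insert none (g.roots.toFinset.image some)).card := Finset.card_le_card hsub
        _ ≤ (g.roots.toFinset.image some).card + 1 := Finset.card_insert_le _ _
        _ = 1 + g.roots.toFinset.card := by
            rw [Finset.card_image_of_injective _ (Option.some_injective F), add_comm]
    have h2' := g.roots.toFinset_card_le
    omega
  have hsplit : (W.twoTorsionPolynomial.toPoly.map (RingHom.id F)).Splits := by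
    rw [Polynomial.map_id, Polynomial.splits_iff_card_roots]
    show g.roots.card = g.natDegree
    have := g.card_roots'
    omega
  exact (Cubic.splits_iff_roots_eq_three ha).mp hsplit

/-- **`E[2] ⊆ E(F)` makes `Δ(E)` a square in `F`**: if `2 ≠ 0` in `F` and `W(F)` contains four
points killed by `2`, then with the three `F`-rational roots `e₁, e₂, e₃` of the `2`-division cubic,
`Δ(W) = 16·((e₁ − e₂)(e₁ − e₃)(e₂ − e₃))² = (4(e₁ − e₂)(e₁ − e₃)(e₂ − e₃))²` (Silverman *AEC*
Prop. III.1.7, proof; Mathlib `twoTorsionPolynomial_discr`: `disc = 16Δ`).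
[cite: SilvermanAEC2009, Prop. III.1.7 (proof: `Δ = 16λ²(λ − 1)²` / `Δ = 16∏(eᵢ − eⱼ)²`)] -/
theorem isSquare_Δ_of_two_torsion (h2 : (2 : F) ≠ 0)
    (S : Finset W.toAffine.Point) (hS : ∀ P ∈ S, (2 : ℕ) • P = 0) (hcard : 4 ≤ S.card) :
    IsSquare W.Δ := by
  have h4 : (4 : F) ≠ 0 := by
    rw [show (4 : F) = 2 * 2 by norm_num]
    exact mul_ne_zero h2 h2
  have h16 : (16 : F) ≠ 0 := by
    rw [show (16 : F) = 4 * 4 by norm_num]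
    exact mul_ne_zero h4 h4
  have ha : W.twoTorsionPolynomial.a ≠ 0 := h4
  obtain ⟨x, y, z, h3⟩ := W.exists_roots_twoTorsionPolynomial_of_two_torsion h2 S hS hcard
  have h := Cubic.discr_eq_prod_three_roots ha h3
  simp only [RingHom.id_apply, twoTorsionPolynomial_discr] at h
  have hPa : W.twoTorsionPolynomial.a = 4 := rfl
  rw [hPa] at h
  refine ⟨4 * ((x - y) * (x - z) * (y - z)), mul_left_cancel₀ h16 ?_⟩
  linear_combination h

/-- **`c₆² = Δ·(j − 1728)`** for an elliptic Weierstrass equation over a field: Mathlib's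
`c_relation` `1728Δ = c₄³ − c₆²` together with `jΔ = c₄³` (Silverman *AEC* III.§1:
`j = c₄³/Δ`, `1728Δ = c₄³ − c₆²`). In particular `Δ` and `j − 1728` have the same square class
whenever `c₆ ≠ 0`. [cite: SilvermanAEC2009, III.§1 (`1728Δ = c₄³ − c₆²`, `j = c₄³/Δ`)] -/
theorem c₆_sq_eq_Δ_mul_j_sub [W.IsElliptic] : W.c₆ ^ 2 = W.Δ * (W.j - 1728) := by
  have hΔ0 : W.Δ ≠ 0 := W.isUnit_Δ.ne_zero
  have h1 := W.c_relation
  have h2 : W.j * W.Δ = W.c₄ ^ 3 := by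
    rw [WeierstrassCurve.j, Units.val_inv_eq_inv_val, coe_Δ', mul_comm, ← mul_assoc,
      mul_inv_cancel₀ hΔ0, one_mul]
  linear_combination h1 - h2

end WeierstrassCurve

namespace Literature.NumberTheory.EllipticCurves.TateCurve

open WeierstrassCurve SteinWuthrich2013

universe u

section Products

variable {K : Type u} [NontriviallyNormedField K] [CompleteSpace K] [IsUltrametricDist K] {q : K}

/-! ### `∏ (1 − qⁿ)²⁴` is a square -/

/-- The product `∏_{n ≥ 1} (1 − qⁿ)¹²` (the square root of `Δ(q)/q`, i.e. `η(q)²⁴/q` with Dedekind's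
`η`) is multipliable for `‖q‖ < 1`: `(1 − qⁿ)¹² = 1 + O(qⁿ)` with `Σ ‖q‖ⁿ < ∞` (same argument as the
tree's `multipliable_tateDelta_factor` for the exponent `24`). [folklore] -/
private theorem multipliable_tateDelta_factor_twelve (hq : ‖q‖ < 1) :
    Multipliable fun n : ℕ ↦ (1 - q ^ (n + 1)) ^ 12 := by
  have heq : (fun n : ℕ ↦ (1 - q ^ (n + 1)) ^ 12) =
      fun n : ℕ ↦ 1 + ((1 - q ^ (n + 1)) ^ 12 - 1) := by
    funext n; ring
  rw [heq]
  refine multipliable_one_add_of_summable ?_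
  refine Summable.of_nonneg_of_le (fun _ ↦ norm_nonneg _) (fun n ↦ ?_)
    ((summable_geometric_of_lt_one (norm_nonneg q) hq).mul_right ‖q‖)
  have h1 : ‖1 - q ^ (n + 1)‖ ≤ 1 := by
    rw [sub_eq_add_neg]
    refine (IsUltrametricDist.norm_add_le_max _ _).trans (max_le (by rw [norm_one]) ?_)
    rw [norm_neg, norm_pow]; exact pow_le_one₀ (norm_nonneg _) hq.le
  calc ‖(1 - q ^ (n + 1)) ^ 12 - 1‖ = ‖(1 - q ^ (n + 1)) ^ 12 - 1 ^ 12‖ := by rw [one_pow]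
    _ ≤ ‖(1 - q ^ (n + 1)) - 1‖ := norm_pow_sub_pow_le h1 (by rw [norm_one]) 12
    _ = ‖q‖ ^ n * ‖q‖ := by rw [sub_sub_cancel_left, norm_neg, norm_pow, pow_succ]

/-- **`∏_{n ≥ 1} (1 − qⁿ)²⁴ = (∏_{n ≥ 1} (1 − qⁿ)¹²)²`** for `‖q‖ < 1`: `Δ(q)/q` is a square in `K`
(Mathlib `Multipliable.tprod_pow`). [folklore] -/
private theorem tprod_tateDelta_factor_eq_sq (hq : ‖q‖ < 1) :
    ∏' n : ℕ, (1 - q ^ (n + 1)) ^ 24 = (∏' n : ℕ, (1 - q ^ (n + 1)) ^ 12) ^ 2 := by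
  rw [← (multipliable_tateDelta_factor_twelve hq).tprod_pow 2]
  refine tprod_congr fun n ↦ ?_
  rw [← pow_mul]

/-- The square root `∏_{n ≥ 1} (1 − qⁿ)¹²` of `Δ(q)/q` is non-zero for `‖q‖ < 1` (indeed `Δ(q)/q` has
norm `1`, tree `norm_tprod_tateDelta_factor_eq_one`). [folklore] -/
private theorem tprod_tateDelta_factor_twelve_ne_zero (hq : ‖q‖ < 1) :
    ∏' n : ℕ, (1 - q ^ (n + 1)) ^ 12 ≠ 0 := by
  intro h
  have h24 : ∏' n : ℕ, (1 - q ^ (n + 1)) ^ 24 = 0 := by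
    rw [tprod_tateDelta_factor_eq_sq hq, h, zero_pow two_ne_zero]
  have h1 := norm_tprod_tateDelta_factor_eq_one hq
  rw [h24, norm_zero] at h1
  exact zero_ne_one h1

/-- For `0 < ‖q‖ < 1` and an elliptic curve `E/K` with `tateJ q = j(E)`: `j(E) ≠ 1728` — indeed
`‖j(E)‖ = ‖q‖⁻¹ > 1 ≥ ‖1728‖` in the ultrametric field `K` (Silverman ATAEC V.3.1 (b):
`|j(E_q)| = |q|⁻¹`). [cite: SilvermanATAEC1994, Thm. V.3.1 (b) (PDF pp. 395–396)] -/
theorem j_sub_ne_zero_of_tateJ_eq (E : WeierstrassCurve K) [E.IsElliptic] (hq0 : q ≠ 0) (hq : ‖q‖ < 1)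
    (hqj : tateJ q = E.j) : E.j - 1728 ≠ 0 := by
  intro h
  have hj : ‖E.j‖ = ‖q‖⁻¹ := by rw [← hqj, norm_tateJ_eq hq]
  have h1 : 1 < ‖E.j‖ := by
    rw [hj]
    exact one_lt_inv_iff₀.mpr ⟨norm_pos_iff.mpr hq0, hq⟩
  have h2 : ‖E.j‖ ≤ 1 := by
    rw [sub_eq_zero.mp h, show (1728 : K) = ((1728 : ℕ) : K) by norm_cast]
    exact IsUltrametricDist.norm_natCast_le_one K 1728
  exact absurd h1 (not_lt.mpr h2)

end Products

/-! ### The `2`-part: a square root of `q` from four rational `2`-torsion points, no splitness -/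

section Tate

variable {K : Type u} [NontriviallyNormedField K] [CompleteSpace K] [IsUltrametricDist K]
  [CharZero K] {q : K}

/-- **The `2`-part of [IUTchI] Ex. 3.2 (iv), WITHOUT splitness: four rational points killed by `2`
on ANY curve with `j(E) = j(E_q)` force `q ∈ (K^×)²`.** Let `K` be a complete ultrametric field of
characteristic `0`, `0 < ‖q‖ < 1`, and `E/K` an elliptic curve with `tateJ q = j(E)` (so `E` is the
Tate curve `E_q` or a quadratic twist of it — no `K`-isomorphism with `E_q`, no split multiplicative
reduction is assumed). If `E(K)` contains a `Finset` of at least four points `P` with `2 • P = O`,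
then `q = r²` for some `r ∈ K`. Proof: `Δ(E)` is a square (`isSquare_Δ_of_two_torsion`);
`c₆² = Δ·(j − 1728)` for `E` and for `E_q`, with the same `j ≠ 1728`, so
`Δ(E_q) = q·∏(1 − qⁿ)²⁴ = q·(∏(1 − qⁿ)¹²)²` (ATAEC V.3.1 (b), tree `tateCurve_discr`) is a square
too, whence so is `q`. Classical counterpart: Silverman ATAEC Lemma V.5.2 / Thm. V.5.3 (a curve with
`|j| > 1` is a quadratic twist of `E_q`; the twist does not change the Galois module `E[2]`).
[cite: SilvermanATAEC1994, Thm. V.3.1 (b) (PDF pp. 394–396) and Lemma V.5.2, Thm. V.5.3 (PDF pp. 406–409)] -/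
theorem exists_sq_eq_of_two_torsion (E : WeierstrassCurve K) [E.IsElliptic] (hq0 : q ≠ 0)
    (hq : ‖q‖ < 1) (hqj : tateJ q = E.j) (S : Finset E.toAffine.Point)
    (hS : ∀ P ∈ S, (2 : ℕ) • P = 0) (hcard : 4 ≤ S.card) : ∃ r : K, r ^ 2 = q := by
  -- `Δ(E) = s²`
  obtain ⟨s, hs⟩ := E.isSquare_Δ_of_two_torsion two_ne_zero S hS hcard
  -- the Tate curve `E_q`: elliptic, `j(E_q) = tateJ q = j(E)`, `Δ(E_q) = q ∏ (1 - qⁿ)²⁴ = q · P₁₂²`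
  haveI := tateCurve_isElliptic hq0 hq
  have hjq : (tateCurve q).j = E.j := by rw [tateCurve_j hq, hqj]
  set P : K := ∏' n : ℕ, (1 - q ^ (n + 1)) ^ 12 with hP
  have hP0 : P ≠ 0 := tprod_tateDelta_factor_twelve_ne_zero hq
  have hΔq : (tateCurve q).Δ = q * P ^ 2 := by
    rw [tateCurve_discr hq]
    unfold tateDelta
    rw [tprod_tateDelta_factor_eq_sq hq]
  -- `c₆² = Δ (j - 1728)` on both sides, `j - 1728 ≠ 0`, hence `c₆(E) ≠ 0`
  set t : K := E.j - 1728 with ht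
  have ht0 : t ≠ 0 := j_sub_ne_zero_of_tateJ_eq E hq0 hq hqj
  have hE : E.c₆ ^ 2 = s * s * t := by rw [← hs]; exact E.c₆_sq_eq_Δ_mul_j_sub
  have hEq : (tateCurve q).c₆ ^ 2 = q * P ^ 2 * t := by
    rw [← hΔq, ht, ← hjq]; exact (tateCurve q).c₆_sq_eq_Δ_mul_j_sub
  have hc₆ : E.c₆ ≠ 0 := by
    intro h0
    rw [h0, zero_pow two_ne_zero] at hE
    have hs0 : s ≠ 0 := fun hs0 ↦ E.isUnit_Δ.ne_zero (by rw [hs, hs0, mul_zero])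
    exact mul_ne_zero (mul_ne_zero hs0 hs0) ht0 hE.symm
  -- the square root of `q`
  refine ⟨(tateCurve q).c₆ * s / (E.c₆ * P), ?_⟩
  rw [div_pow, mul_pow, mul_pow, div_eq_iff (mul_ne_zero (pow_ne_zero 2 hc₆) (pow_ne_zero 2 hP0))]
  linear_combination s ^ 2 * hEq - q * P ^ 2 * hE

/-- The same with the hypothesis `1 < ‖j(E)‖` made explicit and `q` THE Tate parameter of `E`
(`tateParameter E hj`, Silverman ATAEC V.5.3 (a): the unique `q` with `0 < |q| < 1`, `j(E_q) = j(E)`):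
four rational points killed by `2` give `tateParameter E hj = r²`, for `E` with split OR non-split
multiplicative reduction alike. [cite: SilvermanATAEC1994, Thm. V.5.3 (a) (PDF p. 407)] -/
theorem exists_sq_eq_tateParameter_of_two_torsion (E : WeierstrassCurve K) [E.IsElliptic]
    (hj : 1 < ‖E.j‖) (S : Finset E.toAffine.Point) (hS : ∀ P ∈ S, (2 : ℕ) • P = 0)
    (hcard : 4 ≤ S.card) : ∃ r : K, r ^ 2 = tateParameter E hj :=
  exists_sq_eq_of_two_torsion E (tateParameter_ne_zero E hj) (norm_tateParameter_lt_one E hj)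
    (tateJ_tateParameter E hj) S hS hcard

/-- **The `2n`-th root for odd `n` — [IUTchI] Ex. 3.2 (iv) "`q_v` admits a `2l`-th root in `K_v̲`"
assembled WITHOUT splitness.** For `E/K` with `tateJ q = j(E)`, `0 < ‖q‖ < 1`, four rational points
killed by `2` (from [IUTchI] Def. 3.1 (b): `E_F[2] ⊆ E_F(F)`) and ANY `n`-th root `bⁿ = q` with `n`
odd (for `n = l` it comes from `E_F[l] ⊆ E_F(K)`, Def. 3.1 (c), e.g. by `TorsionRootTwist.lean`, or
from `TorsionRoot.exists_pow_eq_of_torsion` in the split case), `q = c^{2n}` for some `c ∈ K`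
(`exists_pow_mul_eq_of_coprime`, Bezout). [cite: SilvermanATAEC1994, Thm. V.3.1 (c)(d), V.5.3 (PDF pp. 395, 407–409)] -/
theorem exists_pow_two_mul_eq_of_two_torsion_of_pow_eq (E : WeierstrassCurve K) [E.IsElliptic]
    (hq0 : q ≠ 0) (hq : ‖q‖ < 1) (hqj : tateJ q = E.j) (S : Finset E.toAffine.Point)
    (hS : ∀ P ∈ S, (2 : ℕ) • P = 0) (hcard : 4 ≤ S.card) {n : ℕ} (hn : Odd n) {b : K}
    (hb : b ^ n = q) : ∃ c : K, c ^ (2 * n) = q := by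
  obtain ⟨r, hr⟩ := exists_sq_eq_of_two_torsion E hq0 hq hqj S hS hcard
  exact exists_pow_mul_eq_of_coprime hq0 (Nat.coprime_two_left.mpr hn) hr hb

/-- **Split case, both halves from torsion counts**: if moreover a `K`-isomorphism `C • E = E_q` is
given (split multiplicative reduction) and `E(K)` also contains `n²` points killed by an odd `n`, then
`q = c^{2n}` — the tree's `exists_pow_eq_of_torsion_of_variableChange` for the odd part and the present
file for the `2`-part (for which the isomorphism is not used).
[cite: SilvermanATAEC1994, Thm. V.3.1 (c)(d) (PDF p. 395), Thm. V.5.3 (PDF pp. 407–409)] -/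
theorem exists_pow_two_mul_eq_of_torsion_of_variableChange (E : WeierstrassCurve K) [E.IsElliptic]
    (hq0 : q ≠ 0) (hq : ‖q‖ < 1) (C : VariableChange K) (hC : C • E = tateCurve q)
    (S₂ : Finset E.toAffine.Point) (hS₂ : ∀ P ∈ S₂, (2 : ℕ) • P = 0) (hcard₂ : 4 ≤ S₂.card)
    {n : ℕ} (hn : Odd n) (Sₙ : Finset E.toAffine.Point) (hSₙ : ∀ P ∈ Sₙ, n • P = 0)
    (hcardₙ : n ^ 2 ≤ Sₙ.card) : ∃ c : K, c ^ (2 * n) = q := by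
  have key : ∀ (W : WeierstrassCurve K) [W.IsElliptic], W = tateCurve q → W.j = tateJ q := by
    rintro W _ rfl
    exact tateCurve_j hq
  have hqj : tateJ q = E.j := by rw [← key (C • E) hC, variableChange_j]
  obtain ⟨b, hb⟩ := exists_pow_eq_of_torsion_of_variableChange E hq0 hq C hC hn.pos Sₙ hSₙ hcardₙ
  exact exists_pow_two_mul_eq_of_two_torsion_of_pow_eq E hq0 hq hqj S₂ hS₂ hcard₂ hn hb

/-! ### Both halves from torsion counts alone: the `2l`-th root of [IUTchI] Ex. 3.2 (iv), no splitness -/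

/-- **[IUTchI] Ex. 3.2 (iv) "`q_v` admits a `2l`-th root in `K_v̲`", from the torsion counts ALONE.**
Let `K` be a complete ultrametric field of characteristic `0`, `0 < ‖q‖ < 1`, and `E/K` elliptic with
`tateJ q = j(E)` (split or non-split multiplicative reduction alike). If `E(K)` contains four points
killed by `2` ([IUTchI] Def. 3.1 (b): `E_F[2·3] ⊆ E_F(F)`) and `n²` points killed by an ODD `n`
(Def. 3.1 (c): `K = F(E_F[l])`, `n = l`), then `q = c^{2n}` for some `c ∈ K`: the `2`-part is
`exists_sq_eq_of_two_torsion` (discriminant parity), the odd part is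
`exists_pow_eq_tateParameter_of_odd_torsion` (`TorsionRootTwist.lean`, seat abc-iut-w5-d181: Tate's
theorem over `K(√γ)` and a norm), glued by Bezout (`exists_pow_mul_eq_of_coprime`). No
`K`-isomorphism with `E_q`, no `HasSplitMultiplicativeReduction` hypothesis.
[cite: SilvermanATAEC1994, Thm. V.3.1 (b)(c)(d) (PDF pp. 394–396), Lemma V.5.2 and Thm. V.5.3 (PDF pp. 406–409)] -/
theorem exists_pow_two_mul_eq_of_torsion (E : WeierstrassCurve K) [E.IsElliptic] (hq0 : q ≠ 0)
    (hq : ‖q‖ < 1) (hqj : tateJ q = E.j)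
    (S₂ : Finset E.toAffine.Point) (hS₂ : ∀ P ∈ S₂, (2 : ℕ) • P = 0) (hcard₂ : 4 ≤ S₂.card)
    {n : ℕ} (hn : Odd n) (Sₙ : Finset E.toAffine.Point) (hSₙ : ∀ P ∈ Sₙ, n • P = 0)
    (hcardₙ : n ^ 2 ≤ Sₙ.card) : ∃ c : K, c ^ (2 * n) = q := by
  have hj : 1 < ‖E.j‖ := by
    rw [← hqj, norm_tateJ_eq hq]
    exact one_lt_inv_iff₀.mpr ⟨norm_pos_iff.mpr hq0, hq⟩
  obtain ⟨b, hb⟩ := exists_pow_eq_tateParameter_of_odd_torsion E hj hq0 hq hqj hn Sₙ hSₙ hcardₙ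
  exact exists_pow_two_mul_eq_of_two_torsion_of_pow_eq E hq0 hq hqj S₂ hS₂ hcard₂ hn hb

/-- The same for THE Tate parameter `tateParameter E hj` of a curve with `1 < ‖j(E)‖` (Silverman
ATAEC V.5.3 (a)): four rational points killed by `2` and `n²` rational points killed by an odd `n`
give `tateParameter E hj = c^{2n}` — e.g. `n = l`: the `2l`-th root `q̲_v` of [IUTchI] Ex. 3.2 (iv).
[cite: SilvermanATAEC1994, Thm. V.5.3 (a) (PDF p. 407), Thm. V.3.1 (b)(c)(d) (PDF pp. 394–396)] -/
theorem exists_pow_two_mul_eq_tateParameter_of_torsion (E : WeierstrassCurve K) [E.IsElliptic]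
    (hj : 1 < ‖E.j‖)
    (S₂ : Finset E.toAffine.Point) (hS₂ : ∀ P ∈ S₂, (2 : ℕ) • P = 0) (hcard₂ : 4 ≤ S₂.card)
    {n : ℕ} (hn : Odd n) (Sₙ : Finset E.toAffine.Point) (hSₙ : ∀ P ∈ Sₙ, n • P = 0)
    (hcardₙ : n ^ 2 ≤ Sₙ.card) : ∃ c : K, c ^ (2 * n) = tateParameter E hj :=
  exists_pow_two_mul_eq_of_torsion E (tateParameter_ne_zero E hj) (norm_tateParameter_lt_one E hj)
    (tateJ_tateParameter E hj) S₂ hS₂ hcard₂ hn Sₙ hSₙ hcardₙ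

/-- **Valuation form**: with `c^{2n} = q` as above, `‖E.j‖ = (‖c‖⁻¹)^{2n}` — i.e.
`2n ∣ ord(q) = −ord j(E)` (the "`|log(q)| = (1/2l)·log(q)`" normalisation of [IUTchIV] Thm. 1.10
reads `‖c‖`). [cite: SilvermanATAEC1994, Thm. V.3.1 (b) (`|j(E_q)| = |q|⁻¹`, PDF pp. 395–396)] -/
theorem exists_pow_two_mul_eq_norm_of_torsion (E : WeierstrassCurve K) [E.IsElliptic] (hq0 : q ≠ 0)
    (hq : ‖q‖ < 1) (hqj : tateJ q = E.j)
    (S₂ : Finset E.toAffine.Point) (hS₂ : ∀ P ∈ S₂, (2 : ℕ) • P = 0) (hcard₂ : 4 ≤ S₂.card)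
    {n : ℕ} (hn : Odd n) (Sₙ : Finset E.toAffine.Point) (hSₙ : ∀ P ∈ Sₙ, n • P = 0)
    (hcardₙ : n ^ 2 ≤ Sₙ.card) :
    ∃ c : K, c ^ (2 * n) = q ∧ ‖E.j‖ = (‖c‖⁻¹) ^ (2 * n) := by
  obtain ⟨c, hc⟩ := exists_pow_two_mul_eq_of_torsion E hq0 hq hqj S₂ hS₂ hcard₂ hn Sₙ hSₙ hcardₙ
  refine ⟨c, hc, ?_⟩
  rw [← hqj, norm_tateJ_eq hq, ← hc, norm_pow, inv_pow]

end Tate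

end Literature.NumberTheory.EllipticCurves.TateCurve

end
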